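import Literature.ComputerArithmetic.Rump2006.CholeskyReciprocalDivision

/-!
# Reciprocal pivot scaling costs NOTHING in Rump's constants: the entrywise backward error
# `γ_{min(i,j)+2}`, the column bound `(1-γ_{j+2})⁻¹ a_jj`, Lemma 10.13 and the criteria hold for a
# `CholeskyRunRecip u` with the SAME `u`

HONEST FRAMING (cell certnum, L1; seat certnum-ila-3): tools and soundness statements; every certified
number belongs to a client cell's ledger. `CholeskyReciprocalDivision` showed that a floating-point
Cholesky whose off-diagonal step is `r̃_{ij} = fl(s̃ · fl(1/r̃_{ii}))` (library `dpotrf`/`dtrsm` shape)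
is a `CholeskyRun (2u+u²)`, which doubles every constant. This module proves the SHARP statement:
the extra rounding is absorbed by the spare rounding that the printed entrywise bound
`|A - R̃ᵀR̃|_{ij} ≤ γ_{min(i,j)+2} (|R̃|ᵀ|R̃|)_{ij}` ([Rump2010Verification] (10.58), [Rump2006] (2.8))
already carries OFF the diagonal (the sharp off-diagonal constant of a textbook run is `γ_{i+1}`,
`CholeskyRun.abs_offDiag_le`; with the reciprocal step it becomes `γ_{i+2}` — still `≤ γ_{min(i,j)+2}`),
while the diagonal stages contain no division at all. Consequently [Rump2010Verification] (10.56)–(10.58),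
(10.57), Lemma 10.13, [Rump2006] Theorem 2.3, Corollary 2.4, Corollary 2.7 / Lemma 10.14 hold for a
`CholeskyRunRecip u A R̃` with the SAME unit roundoff `u` and the SAME constants as printed — so the
engines citing these theorems for LAPACK/CHOLMOD factorizations (cap.ila.psd `fpapriori`,
cap.ila.spd `SPD_THEOREMS`) keep every number. Proofs re-trace the parent file's
(`CholeskyPositiveDefinite`) with the two-rounding division kernel; nothing there is restated with a
different meaning. No named facts, no `sorry`.

PROVED HERE (part 1 of 2 — the ENTRYWISE facts): `CTree.div_factor_recip` /
`CTree.abs_sub_sum_sub_mul_le_recip` (division kernel with a rounded reciprocal: `Ψ₀ ∈ Band u (k+2)`;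
`|c - Σ z - b ỹ| ≤ γ_{k-1} Σ|z| + γ_{k+1} |b ỹ|` in 1-based count, one more than [Rump2006] (2.3));
`CholeskyRunRecip.abs_offDiag_le` (`γ_i Σ + γ_{i+2} |r̃_ii r̃_ij|`), `.abs_diag_le`,
`.sum_mul_self_le_inv_pow`, `.abs_sub_transpose_mul_self_le` (`γ_{min(i,j)+2}` — SAME as printed),
`.abs_sub_transpose_mul_self_le_uniform` (`γ_{n+1}` — SAME), `.sum_sq_le` ((10.57) — SAME). Part 2
(`CholeskyReciprocalDivisionSharpCriteria`): Lemma 10.13, Theorem 2.3 and the criteria with `u`.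
WHAT IS NOT HERE: as in the parent — underflow (`eta`) terms, complex data, sparsity-aware counts,
TRSM-by-block-inversion libraries, the IEEE formats themselves.
-/

namespace Literature.ComputerArithmetic.Rump2006

open Finset Matrix
open Literature.ComputerArithmetic.Higham2002

variable {K : Type*} [Field K] [LinearOrder K] [IsStrictOrderedRing K]

/-! ### The division kernel with a rounded reciprocal -/

namespace CTree

variable {u : K}

/-- DIVISION KERNEL WITH RECIPROCAL SCALING, factor form: `w = fl(1/b)`, `ỹ = fl(s̃ · w)` give
`b ỹ Ψ₀ = c - Σ z_ℓ Ψ_ℓ` with `Ψ₀ ∈ Band u (k+2)` (one more than `div_factor`), `Ψ_ℓ ∈ Band u k`.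
[cite: Rump2006, proof of Lemma 2.1, (2.5)] [cite: Higham2002ASNA, Lemma 8.4 (8.3)] -/
theorem div_factor_recip (hu : 0 ≤ u) (hu1 : u < 1) {e : CTree K} (he : e.WF u) {b w y : K}
    (hb : b ≠ 0) (hw : |w - b⁻¹| ≤ u * |b⁻¹|) (hy : |y - e.val * w| ≤ u * |e.val * w|) :
    ∃ Ψ S : K, Band u (e.terms.length + 2) Ψ ∧ BandSum u e.terms.length e.terms S ∧
      b * y * Ψ = e.const - S := by
  obtain ⟨Ψ, S, hΨ, hS, hid⟩ := e.master hu hu1 he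
  obtain ⟨φ₁, hφ₁, hw'⟩ := Band.of_round hu hu1 hw
  obtain ⟨φ₂, hφ₂, hy'⟩ := Band.of_round hu hu1 hy
  have hφ₁0 : φ₁ ≠ 0 := (hφ₁.pos hu1).ne'
  have hφ₂0 : φ₂ ≠ 0 := (hφ₂.pos hu1).ne'
  refine ⟨(φ₁⁻¹ * φ₂⁻¹) * Ψ, S, ?_, hS, ?_⟩
  · have := ((hφ₁.inv hu1).mul hu1 (hφ₂.inv hu1)).mul hu1 hΨ
    rw [show 1 + 1 + e.terms.length = e.terms.length + 2 by omega] at this; exact this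
  · rw [hy', hw', ← hid]
    calc b * (φ₂ * (e.val * (φ₁ * b⁻¹))) * (φ₁⁻¹ * φ₂⁻¹ * Ψ)
        = (φ₁ * φ₁⁻¹) * (φ₂ * φ₂⁻¹) * (b * b⁻¹) * (e.val * Ψ) := by ring
      _ = e.val * Ψ := by rw [mul_inv_cancel₀ hφ₁0, mul_inv_cancel₀ hφ₂0, mul_inv_cancel₀ hb]; ring

/-- DIVISION KERNEL WITH RECIPROCAL SCALING = [Rump2006] Lemma 2.1 / [Higham2002ASNA] Lemma 8.4 with
one more rounding on the quotient: `|c - Σ_{i<k} a_i b_i - b_k ỹ| ≤ γ_{k-1} Σ |a_i b_i| + γ_{k+1} |b_k ỹ|`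
(the `k - 1` terms are `e.terms`). [cite: Rump2006, Lemma 2.1 and (2.3)] [cite: Higham2002ASNA, Lemma 8.4] -/
theorem abs_sub_sum_sub_mul_le_recip (hu : 0 ≤ u) {e : CTree K} (he : e.WF u) {b w y : K}
    (hb : b ≠ 0) (hw : |w - b⁻¹| ≤ u * |b⁻¹|) (hy : |y - e.val * w| ≤ u * |e.val * w|)
    (hk : ((e.terms.length : K) + 2) * u < 1) :
    |e.const - e.terms.sum - b * y| ≤
      gamma u e.terms.length * (e.terms.map (fun z => |z|)).sum +
        gamma u (e.terms.length + 2) * |b * y| := by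
  have hu1 : u < 1 := by nlinarith [Nat.cast_nonneg (α := K) e.terms.length]
  have hk' : (e.terms.length : K) * u < 1 := by nlinarith
  obtain ⟨Ψ, S, hΨ, hS, hid⟩ := div_factor_recip hu hu1 he hb hw hy
  have h1 := hS.abs_sub_sum_le hu hu1 hk'
  have h2 := hΨ.abs_sub_one_le hu hu1 (by push_cast; exact hk)
  calc |e.const - e.terms.sum - b * y| = |(S - e.terms.sum) + b * y * (Ψ - 1)| := by
        rw [show e.const = b * y * Ψ + S by rw [hid]; ring]; ring_nf
    _ ≤ |S - e.terms.sum| + |b * y * (Ψ - 1)| := abs_add_le _ _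
    _ ≤ _ := by
        apply add_le_add h1
        rw [abs_mul, mul_comm]
        exact mul_le_mul_of_nonneg_right h2 (abs_nonneg _)

end CTree

/-! ### The reciprocal run: entrywise backward error with the PRINTED constants -/

section Cholesky

variable {u : K} {n : ℕ}

namespace CholeskyRunRecip

variable {A R : Matrix (Fin n) (Fin n) K}

/-- Stage `(i, j)`, `i < j`, of a reciprocal run: `|a_{ij} - Σ_{k≤i} r̃_{ki} r̃_{kj}| ≤
γ_i Σ_{k<i} |r̃_{ki} r̃_{kj}| + γ_{i+2} |r̃_{ii} r̃_{ij}|` (0-based `i`: `i` products, a rounded reciprocal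
and a rounded multiplication — one more rounding than the textbook `γ_{i+1}` of
`CholeskyRun.abs_offDiag_le`). [cite: Rump2006, Lemma 2.1 and (2.3)] -/
theorem abs_offDiag_le (hu : 0 ≤ u) (h : CholeskyRunRecip u A R) {i j : Fin n} (hij : i < j)
    (hk : ((i.val : K) + 2) * u < 1) :
    |A i j - ∑ k, R k i * R k j| ≤
      gamma u i.val * (∑ k : Fin i.val,
        |R (Fin.castLE i.isLt.le k) i * R (Fin.castLE i.isLt.le k) j|) +
        gamma u (i.val + 2) * |R i i * R i j| := by
  obtain ⟨e, he, hc, hperm, hii, w, hw, hy⟩ := h.offDiag i j hij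
  have hlen : e.terms.length = i.val := by rw [hperm.length_eq, CholeskyRun.length_prods]
  have hsum : e.terms.sum = ∑ k : Fin i.val,
      R (Fin.castLE i.isLt.le k) i * R (Fin.castLE i.isLt.le k) j := by
    rw [hperm.sum_eq, prods, List.sum_ofFn]
  have habs : (e.terms.map (fun z => |z|)).sum = ∑ k : Fin i.val,
      |R (Fin.castLE i.isLt.le k) i * R (Fin.castLE i.isLt.le k) j| := by
    rw [(hperm.map _).sum_eq, prods, List.map_ofFn, List.sum_ofFn]
    rfl
  have main := CTree.abs_sub_sum_sub_mul_le_recip hu he hii hw hy (by rw [hlen]; exact hk)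
  rw [hlen, hc, hsum, habs] at main
  rw [sum_eq_sum_castLE_add (fun k => R k i * R k j) i
    (fun k hk' => by rw [h.lower k i hk', zero_mul]), ← sub_sub]
  exact main

/-- Stage `(j, j)` of a reciprocal run (no division occurs there): `|a_{jj} - Σ_{k≤j} r̃_{kj}²| ≤
γ_j Σ_{k<j} r̃_{kj}² + γ_{j+2} r̃_{jj}²`, as for a textbook run. [cite: Rump2006, Lemma 2.2] -/
theorem abs_diag_le (hu : 0 ≤ u) (h : CholeskyRunRecip u A R) (j : Fin n)
    (hk : ((j.val : K) + 2) * u < 1) :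
    |A j j - ∑ k, R k j * R k j| ≤
      gamma u j.val * (∑ k : Fin j.val,
        R (Fin.castLE j.isLt.le k) j * R (Fin.castLE j.isLt.le k) j) +
        gamma u (j.val + 2) * (R j j * R j j) := by
  obtain ⟨e, he, hc, hperm, δ, hδ, hy⟩ := h.diag j
  have hlen : e.terms.length = j.val := by rw [hperm.length_eq, CholeskyRun.length_prods]
  have hsum : e.terms.sum = ∑ k : Fin j.val,
      R (Fin.castLE j.isLt.le k) j * R (Fin.castLE j.isLt.le k) j := by
    rw [hperm.sum_eq, prods, List.sum_ofFn]
  have habs : (e.terms.map (fun z => |z|)).sum = ∑ k : Fin j.val,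
      R (Fin.castLE j.isLt.le k) j * R (Fin.castLE j.isLt.le k) j := by
    rw [(hperm.map _).sum_eq, prods, List.map_ofFn, List.sum_ofFn]
    exact sum_congr rfl fun k _ => abs_mul_self _
  have main := CTree.abs_sub_sum_sub_sq_le hu he hδ hy (by rw [hlen]; exact hk)
  rw [hlen, hc, hsum, habs, sq] at main
  rw [sum_eq_sum_castLE_add (fun k => R k j * R k j) j
    (fun k hk' => by rw [h.lower k j hk', zero_mul]), ← sub_sub]
  exact main

/-- Column bound of a reciprocal run: `Σ_{k≤j} r̃_{kj}² ≤ (1-u)^{-(j+2)} a_{jj}` and `a_{jj} ≥ 0`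
(the diagonal stages are untouched by the reciprocal step). [cite: Rump2006, Lemma 2.2 and (2.7)] -/
theorem sum_mul_self_le_inv_pow (hu : 0 ≤ u) (hu1 : u < 1) (h : CholeskyRunRecip u A R)
    (j : Fin n) : ∑ k, R k j * R k j ≤ ((1 - u) ^ (j.val + 2))⁻¹ * A j j ∧ 0 ≤ A j j := by
  obtain ⟨e, he, hc, hperm, δ, hδ, hy⟩ := h.diag j
  have hlen : e.terms.length = j.val := by rw [hperm.length_eq, CholeskyRun.length_prods]
  have hsum : e.terms.sum = ∑ k : Fin j.val,
      R (Fin.castLE j.isLt.le k) j * R (Fin.castLE j.isLt.le k) j := by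
    rw [hperm.sum_eq, prods, List.sum_ofFn]
  have hz : ∀ z ∈ e.terms, 0 ≤ z := by
    intro z hz
    rw [hperm.mem_iff, prods, List.mem_ofFn] at hz
    obtain ⟨k, rfl⟩ := hz
    exact mul_self_nonneg _
  have main := CTree.sq_add_sum_le_inv_pow_mul hu hu1 he hδ hy hz
  rw [hlen, hc, hsum, sq] at main
  rw [sum_eq_sum_castLE_add (fun k => R k j * R k j) j
    (fun k hk' => by rw [h.lower k j hk', zero_mul]), add_comm]
  exact main

/-- [Rump2010Verification] (10.58) = [Rump2006] (2.8) FOR A RECIPROCAL RUN, SAME CONSTANT: if the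
library-shape floating-point Cholesky of the symmetric `A` (off-diagonal step `fl(s̃ · fl(1/r̃_ii))`)
runs to completion (`(n+1)u < 1`) then `|A - R̃ᵀR̃|_{ij} ≤ γ_{min(i,j)+2} (|R̃|ᵀ|R̃|)_{ij}` (0-based).
[cite: Rump2010Verification, (10.58)] [cite: Rump2006, Theorem 2.3 (2.8)] [cite: Demmel1989Cholesky, Lemma 2.1] -/
theorem abs_sub_transpose_mul_self_le (hu : 0 ≤ u) (hn : ((n : K) + 1) * u < 1) (hA : Aᵀ = A)
    (h : CholeskyRunRecip u A R) (i j : Fin n) :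
    |A i j - (Rᵀ * R) i j| ≤ gamma u (min i.val j.val + 2) * ∑ k, |R k i| * |R k j| := by
  have key : ∀ i j : Fin n, i ≤ j →
      |A i j - (Rᵀ * R) i j| ≤ gamma u (i.val + 2) * ∑ k, |R k i| * |R k j| := by
    intro i j hij
    have hi2 : ((i.val : K) + 2) * u < 1 := by
      have : (i.val : K) + 2 ≤ n + 1 := by exact_mod_cast (by omega : i.val + 2 ≤ n + 1)
      nlinarith
    have hg0 : gamma u i.val ≤ gamma u (i.val + 2) :=
      gamma_mono hu (by omega) (by push_cast; exact hi2)
    rw [transpose_mul_self_apply,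
      sum_eq_sum_castLE_add (fun k => |R k i| * |R k j|) i
        (fun k hk' => by rw [h.lower k i hk', abs_zero, zero_mul]), mul_add]
    rcases lt_or_eq_of_le hij with hlt | heq
    · refine (h.abs_offDiag_le hu hlt hi2).trans (add_le_add ?_ (le_of_eq ?_))
      · rw [mul_sum, mul_sum]
        refine sum_le_sum fun k _ => ?_
        rw [abs_mul]
        exact mul_le_mul_of_nonneg_right hg0 (by positivity)
      · rw [abs_mul]
    · subst heq
      refine (h.abs_diag_le hu i hi2).trans (add_le_add ?_ (le_of_eq ?_))
      · rw [mul_sum, mul_sum]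
        refine sum_le_sum fun k _ => ?_
        rw [abs_mul_abs_self]
        exact mul_le_mul_of_nonneg_right hg0 (mul_self_nonneg _)
      · rw [abs_mul_abs_self]
  rcases le_total i j with hij | hji
  · rw [min_eq_left (Fin.le_iff_val_le_val.mp hij)]; exact key i j hij
  · rw [min_eq_right (Fin.le_iff_val_le_val.mp hji)]
    have hAij : A i j = A j i := by
      have := congrFun (congrFun hA i) j
      rw [Matrix.transpose_apply] at this
      exact this.symm
    have hRij : (Rᵀ * R) i j = (Rᵀ * R) j i := by
      rw [transpose_mul_self_apply, transpose_mul_self_apply]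
      exact sum_congr rfl fun k _ => mul_comm _ _
    have hS : ∑ k, |R k i| * |R k j| = ∑ k, |R k j| * |R k i| :=
      sum_congr rfl fun k _ => mul_comm _ _
    rw [hAij, hRij, hS]
    exact key j i hji

/-- [Higham2002ASNA] Theorem 10.3 = [Rump2010Verification] (10.56) FOR A RECIPROCAL RUN, SAME CONSTANT:
`|A - R̃ᵀR̃| ≤ γ_{n+1} |R̃|ᵀ|R̃|` entrywise. [cite: Higham2002ASNA, Theorem 10.3]
[cite: Rump2010Verification, (10.56)] [cite: Demmel1989Cholesky, Lemma 2.1] -/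
theorem abs_sub_transpose_mul_self_le_uniform (hu : 0 ≤ u) (hn : ((n : K) + 1) * u < 1)
    (hA : Aᵀ = A) (h : CholeskyRunRecip u A R) (i j : Fin n) :
    |A i j - (Rᵀ * R) i j| ≤ gamma u (n + 1) * ∑ k, |R k i| * |R k j| := by
  refine (h.abs_sub_transpose_mul_self_le hu hn hA i j).trans
    (mul_le_mul_of_nonneg_right (gamma_mono hu ?_ (by push_cast; exact hn)) (by positivity))
  have := i.isLt; have := j.isLt
  omega

/-- [Rump2010Verification] (10.57) = [Rump2006] (2.7) FOR A RECIPROCAL RUN, SAME CONSTANT: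
`Σ_k r̃_{kj}² ≤ (1 - γ_{j+2})⁻¹ a_{jj}` and `a_{jj} ≥ 0`. [cite: Rump2010Verification, (10.57)] [cite: Rump2006, (2.7)] -/
theorem sum_sq_le (hu : 0 ≤ u) (h2n : 2 * ((n : K) + 1) * u < 1) (h : CholeskyRunRecip u A R)
    (j : Fin n) : ∑ k, R k j ^ 2 ≤ (1 - gamma u (j.val + 2))⁻¹ * A j j ∧ 0 ≤ A j j := by
  have hu1 : u < 1 := by nlinarith [Nat.cast_nonneg (α := K) n]
  have hj : (((j.val + 2 : ℕ) : K)) * u < 1 := by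
    have : (j.val : K) + 2 ≤ n + 1 := by exact_mod_cast (by omega : j.val + 2 ≤ n + 1)
    push_cast; nlinarith
  have hglt : gamma u (j.val + 2) < 1 := gamma_lt_one (by
    have : (j.val : K) + 2 ≤ n + 1 := by exact_mod_cast (by omega : j.val + 2 ≤ n + 1)
    push_cast; nlinarith)
  have hg0 : 0 ≤ gamma u (j.val + 2) := gamma_nonneg hu hj
  obtain ⟨hcol, ha⟩ := h.sum_mul_self_le_inv_pow hu hu1 j
  refine ⟨?_, ha⟩
  have h1 : ((1 - u) ^ (j.val + 2))⁻¹ ≤ 1 + gamma u (j.val + 2) := by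
    linarith [inv_one_sub_pow_sub_one_le_gamma hu1 hj]
  have h2 : 1 + gamma u (j.val + 2) ≤ (1 - gamma u (j.val + 2))⁻¹ := by
    rw [inv_eq_one_div, le_div_iff₀ (by linarith)]
    nlinarith
  calc ∑ k, R k j ^ 2 = ∑ k, R k j * R k j := sum_congr rfl fun k _ => sq _
    _ ≤ ((1 - u) ^ (j.val + 2))⁻¹ * A j j := hcol
    _ ≤ (1 - gamma u (j.val + 2))⁻¹ * A j j :=
        mul_le_mul_of_nonneg_right (h1.trans h2) ha

end CholeskyRunRecip

end Cholesky

end Literature.ComputerArithmetic.Rump2006
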